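import Summits.QuantumFields.BalabanUV.Beta.GAN24.SrecBornSector
import Summits.QuantumFields.BalabanUV.Beta.GAN24.LayerTransportBiLoc

/-!
# `BalabanUV.Beta.GAN24.WardRemainderTransportedLetter` — binder row G-an2-4 ∕ (CONV-C), W-slot CT-W, route «WC-TL» ∕ (Q-R) «QR-LL» (RULING R-gan24p1-g25-1;
# R-gan24p1-g26-1∕-3 exponent ledger `θ = Lc^{−1∕2}`; design `HOME/b2b-balaban-gan24-p1/gen25/QR-DESIGN-v0.md` §3): **ONE (REP)-TRANSPORTED SANDWICH LETTER IN
# UNITS IS LABEL-LOCALISED WITH RATIO `(√Lc)^{−(k+1)}` AT `d = 3`** — the junction «(REP)'s unit transport over `k+1` levels = ONE cubic-weighted `push₃` through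
# the dressed leg chain» (an1 `SrecBornSector.transport_unitStepMap_succ_eq_push₃` ∘ leaf-01 `Push3Nest.transport_push₃`) composed with leaf-01 g64's (LT-3) END
# in `BiLoc` currency (`LayerTransportBiLoc.biLoc_cubic_push₃_layer_three_weight`, p324201 ✓); plus the untransported level (`k = 0`) from the letter's own
# profile (row owner `b2b-balaban-gan24-p1`, gen 28)

NOT IN PRINT; OUR BOOKKEEPING ([folklore] assembly BY NAME; 0 cited facts, 0 `def`, 0 `def … : Prop`, 0 sorry).  HONEST FRAMING (cell contract, verbatim):
«discharging `BetaPertH` makes Bałaban's UV stability UNCONDITIONAL — a real constructive-QFT result; it is NOT the continuum limit and NOT the Clay problem.»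
HONEST DEPENDENCY (verbatim): «continuum YM on T⁴ ⇐ BetaPertH ∧ nine spine estimates (0/9 proved); BetaPertH ⇐ (D1) ∧ (D4) ∧ CAP+tail; G-an2-4 gates asym,
D1 and NE2/3/4.»

WHAT.  §0 scalars (`√(Lc^k) = (√Lc)^k`, the unit scalar `(Lc^{d+1}·Lc^{2(d+1)})^k = (Lc^k)^{3(d+1)}`); §1 **`transport_unitStepMap_eq_cubic_push₃`** (generic `d`,
in-block root `toSite rr`, ff-valued local table `S`): `transport unitStepMap m (k+1) S κ u = (Lc^{k+1})^{3(d+1)} • push₃ T T T S κ u`, `T = legChain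
(respStepBmSeq (toSite rr) Lc) m k` — the `L^{3(d+1)} • push₃ l r w S ν U` object of leaf-01's ledger with `l = r = w = T`, `L = Lc^{k+1}`; §2 the face
weight of leaf-03 ∕ leaf-01 (`hω`): a crude uniform bound (`faceWeight_le_card` ⇒ `locStencil_of_profile`, the `LocStencil` datum §1 needs) and the `L = 1` case
**`faceWeight_one_le`** ⇒ **`biLoc_of_profile_one`** (the faces of the unit block `{y}` are `y`, `y − e_μ`: the slot-weighted profile IS a label localisation
`Cs·2(d+1)e^{δ}·e^{−η‖y−u‖₁}`, any `η ≤ δ`, any rate `≤ m`) — the untransported level `m = n − 1` of the END; §3 **`biLoc_cubic_push₃_dressed_three`** (`d = 3`):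
leaf-01's `biLoc_cubic_push₃_layer_three_weight` with `l = r = w = T` ⨾ `(√(Lc^{k+1}))⁻¹ = ((√Lc)⁻¹)^{k+1}` — under the ledger's hypotheses VERBATIM (three
displays `hT0 ∕ hT1 ∕ hT2` = (N1)∕(N1′)∕Hölder envelopes of the DRESSED composite leg — the ENVELOPE READING; K-LL-4: NOT expected pointwise for the literal,
see §3's docstring), the letter side (`hS, hω`), the charge decomposition (`hQ, hZ, hTl, hTcard`) and THE (S) ROW (`hM0, hP1`), the cubic push
`(Lc^{k+1})^{12} • push₃ T T T S ν U` is `BiLoc … U U (K·((√Lc)⁻¹)^{k+1}·e^{−η‖y−U‖₁}) (κ∕4)`, `η = min(κ∕2, δ∕2)`, `K` leaf-01's explicit constant —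
EXACTLY the `hLT` display of the owner's END `WardRemainderEndThree.wLocStencil_unitS_of_layer`, i.e. the `C·θ^{n−1−m}·ω κ u` shape of `hσ` in
`WardRemainderRows.wLocStencil_unitS_of_unrolled` (p320499 ✓) at `θ = (√Lc)⁻¹`.

Discharges NOTHING of (Q-R) ∕ (LT) ∕ (Q-L) ∕ (C) ∕ (S) ∕ «T2Shape» ∕ «T2Drift» ∕ (hW, hWall): every row enters as a displayed hypothesis; NEVER «G-an2-4 closed»
as (CONV-C); NOT D1, NOT `BetaPertH`, NOT continuum, NOT Clay.  2026-08-22.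
-/

noncomputable section

open Finset
open scoped BigOperators
open Literature.MathematicalPhysics.QuantumFieldTheory
open Literature.MathematicalPhysics.QuantumFieldTheory.Balaban1983to89
open Literature.MathematicalPhysics.QuantumFieldTheory.Balaban1983to89.Beta
open B12Sec2to5 (l1 l1_nonneg)
open B6BondElimination (unitVec)
open ExpKernelCalculus (MKer Site BiLoc Zl Zl_nonneg l1_sub_triangle)
open OneStepResolventKernel (Fib LocStencil)
open LatticeForm (quo)
open AffineAveraging (box toSite)
open StepJetData (biLoc_weaken l1_unitVec)
open Summit.QuantumFields.BalabanUV.Beta.GAN24.Push4 (IsFF)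
open Summit.QuantumFields.BalabanUV.Beta.GAN24.Push4Iter (legChain)
open Summit.QuantumFields.BalabanUV.Beta.GAN24.Push3 (push₃)
open Summit.QuantumFields.BalabanUV.Beta.GAN24.RespStepBmDecompExact (respStepBmSeq)
open Summit.QuantumFields.BalabanUV.Beta.GAN24.SrecBornSector (unitStepMap transport_unitStepMap_succ_eq_push₃)
open Summit.QuantumFields.BalabanUV.Beta.GAN24.AffineUnroll (transport)
open Summit.QuantumFields.BalabanUV.Beta.GAN24.LayerTransportBiLoc (biLoc_cubic_push₃_layer_three_weight)

namespace Summit.QuantumFields.BalabanUV.Beta.GAN24.WardRemainderTransportedLetter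

variable {d Lc : ℕ}

/-! ## §0 Scalar bookkeeping -/

/-- [folklore] `√(Lc^k) = (√Lc)^k`. -/
theorem sqrt_natCast_pow (Lc k : ℕ) : Real.sqrt (((Lc ^ k : ℕ) : ℝ)) = (Real.sqrt (Lc : ℝ)) ^ k := by
  push_cast
  rw [← Real.sqrt_sq (pow_nonneg (Real.sqrt_nonneg (Lc : ℝ)) k), ← pow_mul, mul_comm, pow_mul,
    Real.sq_sqrt (Nat.cast_nonneg Lc)]

/-- [folklore] `(√(Lc^k))⁻¹ = ((√Lc)⁻¹)^k` — the ratio `θ^k` of the END at `θ = (√Lc)⁻¹`. -/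
theorem inv_sqrt_natCast_pow (Lc k : ℕ) : (Real.sqrt (((Lc ^ k : ℕ) : ℝ)))⁻¹ = ((Real.sqrt (Lc : ℝ))⁻¹) ^ k := by
  rw [sqrt_natCast_pow, inv_pow]

/-- [folklore] The unit scalar of `k` transported levels: `(Lc^{d+1}·Lc^{2(d+1)})^k = (Lc^k)^{3(d+1)}`. -/
theorem unitScalar_pow (Lc d k : ℕ) :
    (((Lc : ℝ)) ^ (d + 1) * ((Lc : ℝ)) ^ (2 * (d + 1))) ^ k = (((Lc ^ k : ℕ) : ℝ)) ^ (3 * (d + 1)) := by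
  push_cast
  rw [← pow_add, ← pow_mul, ← pow_mul]
  congr 1
  ring

/-! ## §1 The transport over `k+1` levels in units is ONE cubic-weighted push through the dressed leg chain -/

/-- NOT IN PRINT; OUR BOOKKEEPING (an1's `SrecBornSector.transport_unitStepMap_succ_eq_push₃` ⨾ leaf-01's `Push3Nest.transport_push₃`, scalar by
`unitScalar_pow`).  For an in-block root `toSite rr` and an ff-valued local table `S`, the (REP) transport in the adopted units (`cE = Lc^{d+1}`) over `k+1`
levels from base `m` is, slot by slot, the cubic-weighted three-leg push through the DRESSED leg chain of levels `m, …, m+k` at composite blocking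
`L = Lc^{k+1}`: `transport unitStepMap m (k+1) S κ u = L^{3(d+1)} • push₃ T T T S κ u`, `T = legChain (respStepBmSeq (toSite rr) Lc) m k`. -/
theorem transport_unitStepMap_eq_cubic_push₃ [NeZero Lc] {rr : Fin (d + 1) → ℕ} (hrr : rr ∈ box (d + 1) Lc) (m k : ℕ)
    {S : Fin (d + 1) → (Fin (d + 1) → ℤ) → MKer (d + 1) (Fib d)} (hff : ∀ κ u, IsFF (S κ u))
    (hSl : ∃ Cs δ : ℝ, 0 < δ ∧ LocStencil S Cs δ) (κ : Fin (d + 1)) (u : Fin (d + 1) → ℤ) :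
    transport (unitStepMap Lc (toSite rr) ((Lc : ℝ) ^ (d + 1))) m (k + 1) S κ u
      = ((((Lc ^ (k + 1) : ℕ) : ℝ)) ^ (3 * (d + 1))) •
        push₃ (legChain (respStepBmSeq (toSite rr) Lc) m k) (legChain (respStepBmSeq (toSite rr) Lc) m k)
          (legChain (respStepBmSeq (toSite rr) Lc) m k) S κ u := by
  rw [transport_unitStepMap_succ_eq_push₃ hrr ((Lc : ℝ) ^ (d + 1)) m hff hSl k, unitScalar_pow]

/-! ## §2 The face weight: a crude uniform bound, and the `L = 1` case -/

/-- [folklore] The face weight of the block of label `y` at blocking `L` is at most `2·(d+1)·#box` (every exponential is `≤ 1`). -/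
theorem faceWeight_le_card (L : ℕ) (y u : Fin (d + 1) → ℤ) {δ : ℝ} (hδ : 0 ≤ δ) :
    (∑ μ : Fin (d + 1),
      (∑ v ∈ ((box (d + 1) L).filter (fun v => v μ = L - 1)).image (fun v => (L : ℤ) • y + toSite v), Real.exp (-δ * l1 (v - u))
        + ∑ v ∈ ((box (d + 1) L).filter (fun v => v μ = 0)).image (fun v => (L : ℤ) • y + toSite v - unitVec μ),
            Real.exp (-δ * l1 (v - u))))
      ≤ ((d : ℝ) + 1) * (2 * ((box (d + 1) L).card : ℝ)) := by
  have hle : ∀ (s : Finset (Fin (d + 1) → ℤ)), (∑ v ∈ s, Real.exp (-δ * l1 (v - u))) ≤ (s.card : ℝ) := by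
    intro s
    have h := Finset.sum_le_card_nsmul s (fun v => Real.exp (-δ * l1 (v - u))) 1 fun v _ =>
      Real.exp_le_one_iff.2 (by nlinarith [l1_nonneg (v - u)])
    simpa using h
  have hc1 : ∀ μ : Fin (d + 1), ((((box (d + 1) L).filter (fun v => v μ = L - 1)).image (fun v => (L : ℤ) • y + toSite v)).card : ℝ)
      ≤ ((box (d + 1) L).card : ℝ) := fun μ => by
    exact_mod_cast (Finset.card_image_le).trans (Finset.card_filter_le _ _)
  have hc2 : ∀ μ : Fin (d + 1), ((((box (d + 1) L).filter (fun v => v μ = 0)).image (fun v => (L : ℤ) • y + toSite v - unitVec μ)).card : ℝ)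
      ≤ ((box (d + 1) L).card : ℝ) := fun μ => by
    exact_mod_cast (Finset.card_image_le).trans (Finset.card_filter_le _ _)
  calc (∑ μ : Fin (d + 1),
      (∑ v ∈ ((box (d + 1) L).filter (fun v => v μ = L - 1)).image (fun v => (L : ℤ) • y + toSite v), Real.exp (-δ * l1 (v - u))
        + ∑ v ∈ ((box (d + 1) L).filter (fun v => v μ = 0)).image (fun v => (L : ℤ) • y + toSite v - unitVec μ),
            Real.exp (-δ * l1 (v - u))))
      ≤ ∑ _μ : Fin (d + 1), (2 * ((box (d + 1) L).card : ℝ)) :=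
        Finset.sum_le_sum fun μ _ => by linarith [(hle _).trans (hc1 μ), (hle _).trans (hc2 μ)]
    _ = ((d : ℝ) + 1) * (2 * ((box (d + 1) L).card : ℝ)) := by
        rw [Finset.sum_const, Finset.card_univ, Fintype.card_fin, nsmul_eq_mul]; push_cast; ring

/-- [folklore] A letter family with the slot-weighted profile `|S k u x z a b| ≤ Cs·ω(u)·e^{−m(‖x−u‖₁+‖z−u‖₁)}`, `ω` under a face weight at blocking `L`, is a
local stencil family at rate `m` with the crude constant `Cs·(d+1)·2·#box`. -/
theorem locStencil_of_profile {S : Fin (d + 1) → (Fin (d + 1) → ℤ) → MKer (d + 1) (Fib d)} {ω : (Fin (d + 1) → ℤ) → ℝ} {Cs m δ : ℝ}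
    (hCs : 0 ≤ Cs) (hδ : 0 ≤ δ) (hS : ∀ k u x z a b, |S k u x z a b| ≤ Cs * ω u * Real.exp (-m * (l1 (x - u) + l1 (z - u))))
    {L : ℕ} (y : Fin (d + 1) → ℤ)
    (hω : ∀ u, 0 ≤ ω u ∧ ω u ≤ ∑ μ : Fin (d + 1),
      (∑ v ∈ ((box (d + 1) L).filter (fun v => v μ = L - 1)).image (fun v => (L : ℤ) • y + toSite v), Real.exp (-δ * l1 (v - u))
        + ∑ v ∈ ((box (d + 1) L).filter (fun v => v μ = 0)).image (fun v => (L : ℤ) • y + toSite v - unitVec μ),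
            Real.exp (-δ * l1 (v - u)))) :
    LocStencil S (Cs * (((d : ℝ) + 1) * (2 * ((box (d + 1) L).card : ℝ)))) m := by
  intro k u x z a b
  refine (hS k u x z a b).trans ?_
  have hω' : ω u ≤ ((d : ℝ) + 1) * (2 * ((box (d + 1) L).card : ℝ)) := (hω u).2.trans (faceWeight_le_card L y u hδ)
  have he : 0 ≤ Real.exp (-m * (l1 (x - u) + l1 (z - u))) := (Real.exp_pos _).le
  nlinarith [mul_le_mul_of_nonneg_left hω' hCs]

/-- [folklore] **THE `L = 1` FACE WEIGHT IS A LABEL LOCALISATION**: the faces of the unit block `{y}` are `y` and `y − e_μ`, so the face weight is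
`≤ 2(d+1)·e^{δ}·e^{−δ‖y−u‖₁}`. -/
theorem faceWeight_one_le {L : ℕ} (hL : L = 1) (y u : Fin (d + 1) → ℤ) {δ : ℝ} (hδ : 0 ≤ δ) :
    (∑ μ : Fin (d + 1),
      (∑ v ∈ ((box (d + 1) L).filter (fun v => v μ = L - 1)).image (fun v => (L : ℤ) • y + toSite v), Real.exp (-δ * l1 (v - u))
        + ∑ v ∈ ((box (d + 1) L).filter (fun v => v μ = 0)).image (fun v => (L : ℤ) • y + toSite v - unitVec μ),
            Real.exp (-δ * l1 (v - u))))
      ≤ ((d : ℝ) + 1) * (2 * Real.exp δ) * Real.exp (-δ * l1 (y - u)) := by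
  subst hL
  -- the unit box is `{0}`
  have hbox : ∀ v ∈ box (d + 1) 1, toSite v = 0 := by
    intro v hv
    funext i
    have hi : v i ∈ Finset.range 1 := Fintype.mem_piFinset.1 hv i
    have h0 : v i = 0 := by simpa using hi
    simp [toSite, h0]
  have hcard : ((box (d + 1) 1).card : ℝ) ≤ 1 := by
    have h : (box (d + 1) 1).card ≤ 1 := by
      rw [AffineAveraging.box, Fintype.card_piFinset]; simp
    exact_mod_cast h
  -- each face site is within `ℓ¹`-distance 1 of `y`
  have hface : ∀ μ : Fin (d + 1), ∀ v ∈ ((box (d + 1) 1).filter (fun v => v μ = 1 - 1)).image (fun v => ((1 : ℕ) : ℤ) • y + toSite v)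
      ∪ ((box (d + 1) 1).filter (fun v => v μ = 0)).image (fun v => ((1 : ℕ) : ℤ) • y + toSite v - unitVec μ),
      Real.exp (-δ * l1 (v - u)) ≤ Real.exp δ * Real.exp (-δ * l1 (y - u)) := by
    intro μ v hv
    rw [← Real.exp_add]
    refine Real.exp_le_exp.2 ?_
    have hdist : l1 (y - u) ≤ 1 + l1 (v - u) := by
      rcases Finset.mem_union.1 hv with h | h
      · obtain ⟨v', hv', rfl⟩ := Finset.mem_image.1 h
        rw [hbox v' (Finset.mem_filter.1 hv').1]
        simp only [Nat.cast_one, one_smul, add_zero]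
        linarith [l1_nonneg (y - u)]
      · obtain ⟨v', hv', rfl⟩ := Finset.mem_image.1 h
        rw [hbox v' (Finset.mem_filter.1 hv').1]
        simp only [Nat.cast_one, one_smul, add_zero]
        have h1 := l1_sub_triangle y (y - unitVec μ) u
        have h2 : l1 (y - (y - unitVec μ)) = 1 := by
          rw [show y - (y - unitVec μ) = (unitVec μ : Fin (d + 1) → ℤ) by abel]; exact l1_unitVec μ
        linarith
    nlinarith
  have hsum : ∀ (s : Finset (Fin (d + 1) → ℤ)), (s.card : ℝ) ≤ 1 →
      (∀ v ∈ s, Real.exp (-δ * l1 (v - u)) ≤ Real.exp δ * Real.exp (-δ * l1 (y - u))) →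
      (∑ v ∈ s, Real.exp (-δ * l1 (v - u))) ≤ Real.exp δ * Real.exp (-δ * l1 (y - u)) := by
    intro s hs hb
    have h := Finset.sum_le_card_nsmul s (fun v => Real.exp (-δ * l1 (v - u))) _ hb
    refine h.trans ?_
    rw [nsmul_eq_mul]
    have hp : 0 ≤ Real.exp δ * Real.exp (-δ * l1 (y - u)) := by positivity
    nlinarith
  have hc1 : ∀ μ : Fin (d + 1), ((((box (d + 1) 1).filter (fun v => v μ = 1 - 1)).image (fun v => ((1 : ℕ) : ℤ) • y + toSite v)).card : ℝ) ≤ 1 :=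
    fun μ => le_trans (by exact_mod_cast (Finset.card_image_le).trans (Finset.card_filter_le _ _)) hcard
  have hc2 : ∀ μ : Fin (d + 1),
      ((((box (d + 1) 1).filter (fun v => v μ = 0)).image (fun v => ((1 : ℕ) : ℤ) • y + toSite v - unitVec μ)).card : ℝ) ≤ 1 :=
    fun μ => le_trans (by exact_mod_cast (Finset.card_image_le).trans (Finset.card_filter_le _ _)) hcard
  calc (∑ μ : Fin (d + 1),
      (∑ v ∈ ((box (d + 1) 1).filter (fun v => v μ = 1 - 1)).image (fun v => ((1 : ℕ) : ℤ) • y + toSite v), Real.exp (-δ * l1 (v - u))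
        + ∑ v ∈ ((box (d + 1) 1).filter (fun v => v μ = 0)).image (fun v => ((1 : ℕ) : ℤ) • y + toSite v - unitVec μ),
            Real.exp (-δ * l1 (v - u))))
      ≤ ∑ _μ : Fin (d + 1), (2 * Real.exp δ) * Real.exp (-δ * l1 (y - u)) :=
        Finset.sum_le_sum fun μ _ => by
          have h1 := hsum _ (hc1 μ) fun v hv => hface μ v (Finset.mem_union.2 (Or.inl hv))
          have h2 := hsum _ (hc2 μ) fun v hv => hface μ v (Finset.mem_union.2 (Or.inr hv))
          linarith
    _ = ((d : ℝ) + 1) * (2 * Real.exp δ) * Real.exp (-δ * l1 (y - u)) := by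
        rw [Finset.sum_const, Finset.card_univ, Fintype.card_fin, nsmul_eq_mul]; push_cast; ring

/-- NOT IN PRINT; OUR BOOKKEEPING.  **THE UNTRANSPORTED TERM (`k = 0`, `m = n − 1`)**: a letter family with the slot-weighted profile under the `L = 1`
face weight of label `y` is bi-localised at its own slot with the LABEL weight `e^{−η‖y−u‖₁}` for every `η ≤ δ`, constant `Cs·2(d+1)e^{δ}`, at any rate
`r ≤ m`. -/
theorem biLoc_of_profile_one {S : Fin (d + 1) → (Fin (d + 1) → ℤ) → MKer (d + 1) (Fib d)} {ω : (Fin (d + 1) → ℤ) → ℝ} {Cs m δ η r : ℝ}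
    (hCs : 0 ≤ Cs) (hδ : 0 ≤ δ) (hηδ : η ≤ δ) (hrm : r ≤ m)
    (hS : ∀ k u x z a b, |S k u x z a b| ≤ Cs * ω u * Real.exp (-m * (l1 (x - u) + l1 (z - u))))
    {L : ℕ} (hL : L = 1) (y : Fin (d + 1) → ℤ)
    (hω : ∀ u, 0 ≤ ω u ∧ ω u ≤ ∑ μ : Fin (d + 1),
      (∑ v ∈ ((box (d + 1) L).filter (fun v => v μ = L - 1)).image (fun v => (L : ℤ) • y + toSite v), Real.exp (-δ * l1 (v - u))
        + ∑ v ∈ ((box (d + 1) L).filter (fun v => v μ = 0)).image (fun v => (L : ℤ) • y + toSite v - unitVec μ),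
            Real.exp (-δ * l1 (v - u))))
    (k : Fin (d + 1)) (u : Fin (d + 1) → ℤ) :
    BiLoc (S k u) u u (Cs * (((d : ℝ) + 1) * (2 * Real.exp δ)) * Real.exp (-η * l1 (y - u))) r := by
  have h1 : BiLoc (S k u) u u (Cs * (((d : ℝ) + 1) * (2 * Real.exp δ)) * Real.exp (-η * l1 (y - u))) m := by
    intro x z a b
    refine (hS k u x z a b).trans ?_
    have hω' : ω u ≤ ((d : ℝ) + 1) * (2 * Real.exp δ) * Real.exp (-δ * l1 (y - u)) := (hω u).2.trans (faceWeight_one_le hL y u hδ)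
    have hηe : Real.exp (-δ * l1 (y - u)) ≤ Real.exp (-η * l1 (y - u)) := Real.exp_le_exp.2 (by nlinarith [l1_nonneg (y - u)])
    have he : 0 ≤ Real.exp (-m * (l1 (x - u) + l1 (z - u))) := (Real.exp_pos _).le
    have hp : 0 ≤ ((d : ℝ) + 1) * (2 * Real.exp δ) := by positivity
    have hω'' : ω u ≤ ((d : ℝ) + 1) * (2 * Real.exp δ) * Real.exp (-η * l1 (y - u)) := hω'.trans (mul_le_mul_of_nonneg_left hηe hp)
    nlinarith [mul_le_mul_of_nonneg_left hω'' hCs]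
  exact biLoc_weaken h1 le_rfl hrm


/-! ## §3 `d = 3`: ONE letter pushed through the DRESSED chain of `k+1` levels — leaf-01's (LT-3) END, ENVELOPE READING -/

section Three

variable [NeZero Lc]

/-- NOT IN PRINT; OUR BOOKKEEPING (leaf-01 g64's `LayerTransportBiLoc.biLoc_cubic_push₃_layer_three_weight` with `l = r = w = T` ⨾ `inv_sqrt_natCast_pow`).
**THE CUBIC PUSH OF ONE LETTER THROUGH THE DRESSED CHAIN, AT `d = 3`, ENVELOPE READING.**  Let `T = legChain (respStepBmSeq (toSite rr) Lc) m k` be the DRESSED composite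
leg of levels `m, …, m+k` (blocking `L = Lc^{k+1}`; by §1 the cubic push through `T T T` IS the (REP) unit transport), ASSUMED GIVEN BY ENVELOPES — the three displayed
hypotheses `hT0 ∕ hT1 ∕ hT2` = (N1)∕(N1′)∕Hölder second differences with the `√L`.  HONEST (K-LL-4, leaf-01 g63 R-5 ∕ RULING R-gan24p1-g26-2∕-3): for the LITERAL dressed chain
`hT1 ∕ hT2` are NOT expected pointwise (the accumulated gauge function `RespStepBmDecompPsi.Psi` is piecewise constant and JUMPS across block faces — seams); the route of
record moves the dressing onto the letters ((ii-G) closed by name, (ii-T)∕(b3) `LayerPushGaugeTable(Cell)`, seams ≡ the (S)∕moment item by E17) and will supply the SAME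
`BiLoc` conclusion under other hypotheses — which is why the END `WardRemainderEndThree.wLocStencil_unitS_of_layer` displays this conclusion (`hLT`), not these envelopes.
Letter side: `S` with the slot-weighted profile `hS` under the face weight `hω` of the block of label `y` at blocking `L`, label-decomposed charge profiles `Z` over labels `T'`
(`hQ ∕ hZ`) of zero mass and zero first moments (`hM0 ∕ hP1` = THE (S) ROW), label count `hTl ∕ hTcard`.  Conclusion: the cubic push is bi-localised at every output slot
`(ν, U)` at rate `κ∕4` with constant `K·θ^{k+1}·e^{−η‖y−U‖₁}`, `θ = (√Lc)⁻¹`, `η = min(κ∕2, δ∕2)`, `K` leaf-01's explicit constant. -/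
theorem biLoc_cubic_push₃_dressed_three (rr : Fin (3 + 1) → ℕ) (m k : ℕ)
    {S : Fin (3 + 1) → (Fin (3 + 1) → ℤ) → MKer (3 + 1) (Fib 3)} {ω : (Fin (3 + 1) → ℤ) → ℝ}
    {Z : Fin (3 + 1) → Fin (3 + 1) → Fin (3 + 1) → (Fin (3 + 1) → ℤ) → (Fin (3 + 1) → ℤ) → ℝ} {T' : Finset (Fin (3 + 1) → ℤ)}
    {A A' A'' Cs κ m' δ B δZ ρ CT : ℝ}
    (hκ : 0 < κ) (hm : κ < m') (hδ : 0 < δ) (hA : 0 ≤ A) (hA' : 0 ≤ A') (hA'' : 0 ≤ A'') (hCs : 0 ≤ Cs) (hB : 0 ≤ B) (hκδZ : 4 * κ < δZ)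
    (hT0 : ∀ α x' k' x, |legChain (respStepBmSeq (toSite rr) Lc) m k α x' k' x|
      ≤ A * ((((Lc ^ (k + 1) : ℕ) : ℝ)) ^ (3 + 2))⁻¹ * Real.exp (-κ * l1 (quo (Lc ^ (k + 1)) x - x')))
    (hT1 : ∀ α x' k' x i, |legChain (respStepBmSeq (toSite rr) Lc) m k α x' k' (x + Pi.single i 1) - legChain (respStepBmSeq (toSite rr) Lc) m k α x' k' x|
      ≤ A' * ((((Lc ^ (k + 1) : ℕ) : ℝ)) ^ (3 + 3))⁻¹ * Real.exp (-κ * l1 (quo (Lc ^ (k + 1)) x - x')))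
    (hT2 : ∀ α x' k' x i j, |(legChain (respStepBmSeq (toSite rr) Lc) m k α x' k' (x + Pi.single i 1 + Pi.single j 1)
        - legChain (respStepBmSeq (toSite rr) Lc) m k α x' k' (x + Pi.single j 1))
        - (legChain (respStepBmSeq (toSite rr) Lc) m k α x' k' (x + Pi.single i 1) - legChain (respStepBmSeq (toSite rr) Lc) m k α x' k' x)|
      ≤ A'' * ((((Lc ^ (k + 1) : ℕ) : ℝ)) ^ (3 + 3) * Real.sqrt (((Lc ^ (k + 1) : ℕ) : ℝ)))⁻¹ * Real.exp (-κ * l1 (quo (Lc ^ (k + 1)) x - x')))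
    (hS : ∀ k' u x z a b, |S k' u x z a b| ≤ Cs * ω u * Real.exp (-m' * (l1 (x - u) + l1 (z - u))))
    (y : Fin (3 + 1) → ℤ)
    (hω : ∀ u, 0 ≤ ω u ∧ ω u ≤ ∑ μ : Fin (3 + 1),
      (∑ v ∈ ((box (3 + 1) (Lc ^ (k + 1))).filter (fun v => v μ = Lc ^ (k + 1) - 1)).image (fun v => ((Lc ^ (k + 1) : ℕ) : ℤ) • y + toSite v),
          Real.exp (-δ * l1 (v - u))
        + ∑ v ∈ ((box (3 + 1) (Lc ^ (k + 1))).filter (fun v => v μ = 0)).image (fun v => ((Lc ^ (k + 1) : ℕ) : ℤ) • y + toSite v - unitVec μ),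
            Real.exp (-δ * l1 (v - u))))
    (hQ : ∀ k' κ₁ κ₂ u, ∑' x, ∑' z, S k' u x z (Sum.inl κ₁) (Sum.inl κ₂) = ∑ y' ∈ T', Z k' κ₁ κ₂ y' u)
    (hZ : ∀ k' κ₁ κ₂, ∀ y' ∈ T', ∀ e, |Z k' κ₁ κ₂ y' e| ≤ B * Real.exp (-δZ * l1 (e - y')))
    (hM0 : ∀ k' κ₁ κ₂, ∀ y' ∈ T', ∑' e, Z k' κ₁ κ₂ y' e = 0)
    (hP1 : ∀ k' κ₁ κ₂, ∀ y' ∈ T', ∀ i : Fin (3 + 1), ∑' e, (((e - y') i : ℤ) : ℝ) * Z k' κ₁ κ₂ y' e = 0)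
    (hTl : ∀ y' ∈ T', l1 (quo (Lc ^ (k + 1)) y' - y) ≤ ρ) (hTcard : (T'.card : ℝ) ≤ CT * (((Lc ^ (k + 1) : ℕ) : ℝ)) ^ (3 + 1))
    (ν : Fin (3 + 1)) (U : Fin (3 + 1) → ℤ) :
    BiLoc (((((Lc ^ (k + 1) : ℕ) : ℝ)) ^ (3 * (3 + 1))) •
        push₃ (legChain (respStepBmSeq (toSite rr) Lc) m k) (legChain (respStepBmSeq (toSite rr) Lc) m k)
          (legChain (respStepBmSeq (toSite rr) Lc) m k) S ν U) U U
      ((((((3 : ℝ) + 1) ^ 3 * A ^ 2 * A' * Cs * (2 / (m' - κ) * Zl (3 + 1) ((m' - κ) / 2)) * (Zl (3 + 1) (m' - κ) + Zl (3 + 1) m'))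
            * ((2 * ((3 : ℝ) + 1)) ^ 2 * Zl (3 + 1) (δ / 2) * Real.exp (min (κ / 2) (δ / 2))))
        + ((3 : ℝ) + 1) ^ 3 *
          ((((A'' * A * A + 2 * A' * A' * A + A * A'' * A) * Real.exp (2 * κ) + 2 * ((A' * A + A * A') * Real.exp κ) * A' + A * A * A'')
              * Real.exp (2 * (2 * κ))) * B * (8 / (δZ - 2 * (2 * κ)) ^ 2 * Zl (3 + 1) ((δZ - 2 * (2 * κ)) / 4)) * Real.exp ((κ / 2) * ρ) * CT))
        * ((Real.sqrt (Lc : ℝ))⁻¹) ^ (k + 1) * Real.exp (-(min (κ / 2) (δ / 2)) * l1 (y - U)))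
      (κ / 4) := by
  have hL : 1 ≤ Lc ^ (k + 1) := Nat.one_le_pow _ _ (Nat.pos_of_ne_zero (NeZero.ne Lc))
  have h := biLoc_cubic_push₃_layer_three_weight hL hκ hm hδ hA hA' hA'' hCs hB hκδZ hT0 hT1 hT2 hT0 hT1 hT2 hT0 hT1 hT2 hS y hω hQ hZ hM0 hP1
    hTl hTcard ν U
  rw [inv_sqrt_natCast_pow] at h
  exact h

end Three

end Summit.QuantumFields.BalabanUV.Beta.GAN24.WardRemainderTransportedLetter

end
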